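import Summits.HodgeConjecture.HodgeConjecture.Theorems.K2E3QuasiSplitUnitaryCartanAnyInvolution   -- ★ (K2E3-p09): `exists_unitaryInt_mul_mul_eq_diagonalGL` — the Cartan COVER for ANY isometric involution
import Literature.NumberTheory.Automorphic.HyperspecialUnitaryIwasawaTorus                        -- ★ `diagonalGL_mem_unitaryGroupOfForm_of_norm`, `diagonalGL_mem_unitaryInt_of_norm`
import Literature.NumberTheory.Automorphic.HeckeTransversalGL                                      -- ★ `permGL` (the Weyl flip)
import Literature.NumberTheory.K2Lit.LocalDoublingUnramifiedHecke                                  -- ★ D7d `IsCartanFamily`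
import HarnessLib

/-!
# The rank-one Cartan family of `U(σ, J₀)(K)`, `J₀ = antidiag(1,1)`, at ANY non-split place: `U = ⨆_{j ∈ ℕ} K₀ · diag(ϖ^j, (σϖ^j)⁻¹) · K₀`
# for `K₀ = U ∩ GL₂(𝒪)`, ANY isometric involution `σ`, ANY uniformiser `ϖ` (ramified, wild, dyadic, non-`σ`-fixed `ϖ` alike)

Track B ∕ K2-LIT, hLiu418 = stmt-HodgeConjecture-24832; socket #32dR `sig_K2LiuDoublingHeightDecayLocalR2` (U5d ED. 5 :554) through ★
`K2LiuDoublingHeightDecayLocalR2OfNonsplitData.doublingHeightDecayLocalR2_of_nonsplitData` (K2Liu-p04 g3, p857289): at a NON-SPLIT `v ∈ S` with `V_v`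
isotropic the closer wants a rank-one Cartan decay datum `(K₀, tv, C₁, Q, C₂, r)`, in particular a ★ D7d `IsCartanFamily K₀ tv` indexed by `ℕ`.
LEAD F0P6-plan (g11) deal (26-r) 04:33:49Z (3) ∕ 04:36:28Z → K2Liu-p04 (g4); REPORT-FIRST `K2/K2Liu-p04/g4/REPORT-FIRST-26r-IsotropicAnyPlace.K2Liup04g4.md` (F1).
THIS FILE is the place-independent group theory of (F1), in the one-place model `U(σ, J₀)(K)` of a hermitian plane with a RATIONAL hyperbolic frame:

* §1 `v_mul_apply_le_of_left ∕ _of_right` — multiplying by a matrix with integral entries does not increase the maximal entry valuation;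
  `forall_v_le_of_mem_doubleCoset`, `exists_le_v_of_mem_doubleCoset` — so on a double coset `K₀ b K₀` the maximal entry valuation is that of `b`.
* §2 `exists_cartanFamily_two` — elements `b_j ∈ U(σ, J₀)` with matrix `diag(ϖ^j, (σϖ^j)⁻¹)` exist (★ `diagonalGL_mem_unitaryGroupOfForm_of_norm`).
* §3 **`isCartanFamily_unitaryInt_two`** — for ANY involution `σ` with `v ∘ σ = v` and ANY uniformiser `ϖ`, such a family is a ★ `IsCartanFamily` for
  `K₀ = unitaryInt σ J₀`: COVER from ★ K2E3-p09 `exists_unitaryInt_mul_mul_eq_diagonalGL` (`k₁ g k₂ = diag(x, (σx)⁻¹)`), normalised by a unit diagonal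
  (`v x ≤ 1`) or after the Weyl flip `permGL (swap 0 1) ∈ K₀` (`v x > 1`); DISJOINTNESS by §1 (`max v = exp j` on `K₀ b_j K₀`).
No (trace)∕(norm), no `σ ϖ = ϖ`, no `2 ≠ 0`: the stabiliser `K₀` of the (rational) hyperbolic lattice is special but not hyperspecial at a ramified or
non-unimodular place — irrelevant for #32dR, which only needs the family, a volume bound (F2) and the decay (F3).
Theorems only; no `def`, no `sorry`, default heartbeats.  [BruhatTits1972, (4.4.3)]; [Tits1979, §3.3.3]; [Macdonald1971, Ch. V §2–§3]; [GarrettBuildings1997, §18.4].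
HONEST LABEL: HC_CM is proved only modulo the 7 printed citations (2 remaining named inputs: hLiu418 = stmt-HodgeConjecture-24832, h413 =
stmt-HodgeConjecture-24833) until rung 0 closes; count-neutral helper toward #32dR (organ (26-r)), retires nothing by itself.
-/

set_option autoImplicit false
-- the mandated namespace repeats the single-problem summit's segment (`HodgeConjecture.HodgeConjecture`)
set_option linter.dupNamespace false

noncomputable section

open scoped Valued WithZero Matrix MatrixGroups
open Matrix

namespace Summit.HodgeConjecture.HodgeConjecture.Cruxes.HLiu418.K2LiuRankOneCartanAnyPlace

open Literature.NumberTheory.Automorphic Literature.NumberTheory.Automorphic.HermitianLattice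
open Literature.NumberTheory.K2Lit.SiegelDoubled
open Summit.HodgeConjecture.HodgeConjecture.Cruxes.H413.K2E3QuasiSplitUnitaryCartanAnyInvolution

variable {K : Type} [Field K] [Valued K ℤᵐ⁰]

/-! ## §1 The maximal entry valuation is constant on a `GL(𝒪)`-double coset -/

section Entries

variable {ι : Type*} [Fintype ι]

/-- left multiplication by a matrix with integral entries does not increase the entry bound. [cite: Macdonald1971, Ch. V §2] -/
theorem v_mul_apply_le_of_left {A B : Matrix ι ι K} {c : ℤᵐ⁰} (hA : ∀ i j, Valued.v (A i j) ≤ 1) (hB : ∀ i j, Valued.v (B i j) ≤ c) (i j : ι) :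
    Valued.v ((A * B) i j) ≤ c := by
  rw [Matrix.mul_apply]
  refine Valuation.map_sum_le _ fun l _ => ?_
  rw [map_mul]
  calc Valued.v (A i l) * Valued.v (B l j) ≤ 1 * c := mul_le_mul' (hA i l) (hB l j)
    _ = c := one_mul c

/-- right multiplication by a matrix with integral entries does not increase the entry bound. [cite: Macdonald1971, Ch. V §2] -/
theorem v_mul_apply_le_of_right {A B : Matrix ι ι K} {c : ℤᵐ⁰} (hA : ∀ i j, Valued.v (A i j) ≤ c) (hB : ∀ i j, Valued.v (B i j) ≤ 1) (i j : ι) :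
    Valued.v ((A * B) i j) ≤ c := by
  rw [Matrix.mul_apply]
  refine Valuation.map_sum_le _ fun l _ => ?_
  rw [map_mul]
  calc Valued.v (A i l) * Valued.v (B l j) ≤ c * 1 := mul_le_mul' (hA i l) (hB l j)
    _ = c := mul_one c

end Entries

section Shells

variable {σ : K →+* K} {N : ℕ}

/-- on a double coset `K₀ b K₀` (`K₀ = U(σ, J₀) ∩ GL_N(𝒪)`) every entry valuation is bounded by the maximal entry valuation of `b`.
[cite: Macdonald1971, Ch. V §2] [cite: BruhatTits1972, (4.4.3)] -/
theorem forall_v_le_of_mem_doubleCoset {b g : unitaryGroupOfForm σ ((StdForm.antidiagonal N).over K)} {c : ℤᵐ⁰}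
    (hb : ∀ i j, Valued.v (((b : GL (Fin N) K) : Matrix (Fin N) (Fin N) K) i j) ≤ c)
    (hg : g ∈ DoubleCoset.doubleCoset b (unitaryInt σ ((StdForm.antidiagonal N).over K) : Set _)
      (unitaryInt σ ((StdForm.antidiagonal N).over K))) :
    ∀ i j, Valued.v (((g : GL (Fin N) K) : Matrix (Fin N) (Fin N) K) i j) ≤ c := by
  obtain ⟨x, hx, y, hy, rfl⟩ := DoubleCoset.mem_doubleCoset.1 hg
  intro i j
  rw [Subgroup.coe_mul, Subgroup.coe_mul, Units.val_mul, Units.val_mul]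
  exact v_mul_apply_le_of_right (v_mul_apply_le_of_left (mem_unitaryInt_iff.1 hx).1 hb) (mem_unitaryInt_iff.1 hy).1 i j

/-- conversely some entry of `g ∈ K₀ b K₀` has valuation at least any given entry valuation of `b` (`b = x⁻¹ g y⁻¹` with `x⁻¹, y⁻¹` integral).
[cite: Macdonald1971, Ch. V §2] [cite: BruhatTits1972, (4.4.3)] -/
theorem exists_le_v_of_mem_doubleCoset {b g : unitaryGroupOfForm σ ((StdForm.antidiagonal N).over K)} (i₀ j₀ : Fin N)
    (hg : g ∈ DoubleCoset.doubleCoset b (unitaryInt σ ((StdForm.antidiagonal N).over K) : Set _)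
      (unitaryInt σ ((StdForm.antidiagonal N).over K))) :
    ∃ i j, Valued.v (((b : GL (Fin N) K) : Matrix (Fin N) (Fin N) K) i₀ j₀) ≤ Valued.v (((g : GL (Fin N) K) : Matrix (Fin N) (Fin N) K) i j) := by
  classical
  obtain ⟨x, hx, y, hy, rfl⟩ := DoubleCoset.mem_doubleCoset.1 hg
  -- the maximal entry valuation `c` of `g := x b y`
  obtain ⟨⟨i, j⟩, -, hmax⟩ := Finset.exists_max_image (Finset.univ : Finset (Fin N × Fin N))
    (fun p => Valued.v ((((x * b * y : unitaryGroupOfForm σ ((StdForm.antidiagonal N).over K)) : GL (Fin N) K) : Matrix (Fin N) (Fin N) K) p.1 p.2))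
    ⟨(i₀, j₀), Finset.mem_univ _⟩
  refine ⟨i, j, ?_⟩
  -- `b = x⁻¹ (x b y) y⁻¹`, and `x⁻¹`, `y⁻¹` are integral
  have hb : b = x⁻¹ * (x * b * y) * y⁻¹ := by group
  have key := forall_v_le_of_mem_doubleCoset (b := x * b * y) (g := b) (c := Valued.v
      ((((x * b * y : unitaryGroupOfForm σ ((StdForm.antidiagonal N).over K)) : GL (Fin N) K) : Matrix (Fin N) (Fin N) K) i j))
    (fun i' j' => hmax (i', j') (Finset.mem_univ _))
    (DoubleCoset.mem_doubleCoset.2 ⟨x⁻¹, Subgroup.inv_mem _ hx, y⁻¹, Subgroup.inv_mem _ hy, hb⟩)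
  exact key i₀ j₀

end Shells

/-! ## §2 The torus elements `b_j = diag(ϖ^j, (σϖ^j)⁻¹)` of `U(σ, J₀)`, `N = 2` -/

section Torus

variable {σ : K →+* K}

omit [Valued K ℤᵐ⁰] in
/-- `Fin.rev` on `Fin 2` is the swap. [folklore] -/
theorem rev_zero_two : (Fin.rev 0 : Fin 2) = 1 := rfl

omit [Valued K ℤᵐ⁰] in
/-- `Fin.rev` on `Fin 2` is the swap. [folklore] -/
theorem rev_one_two : (Fin.rev 1 : Fin 2) = 0 := rfl

omit [Valued K ℤᵐ⁰] in
/-- the norm condition `σ(w_i) · w_{rev i} = 1` for the pair `(x, (σx)⁻¹)` (`σ` an involution). [cite: Tits1979, §3.3.2] -/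
theorem norm_pair (hσ : ∀ x, σ (σ x) = x) {x : K} (hx : x ≠ 0) (hσx : σ x ≠ 0) (i : Fin 2) :
    σ ((![Units.mk0 x hx, (Units.mk0 (σ x) hσx)⁻¹] i : Kˣ) : K) * ((![Units.mk0 x hx, (Units.mk0 (σ x) hσx)⁻¹] (Fin.rev i) : Kˣ) : K) = 1 := by
  fin_cases i
  · simp only [Fin.zero_eta, Matrix.cons_val_zero, Units.val_mk0, rev_zero_two, Fin.isValue, Matrix.cons_val_one, Matrix.cons_val_fin_one,
      Units.val_inv_eq_inv_val]
    exact mul_inv_cancel₀ hσx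
  · simp only [Fin.mk_one, Fin.isValue, Matrix.cons_val_one, Matrix.cons_val_fin_one, Units.val_inv_eq_inv_val, Units.val_mk0, map_inv₀, hσ,
      rev_one_two, Matrix.cons_val_zero]
    exact inv_mul_cancel₀ hx

omit [Valued K ℤᵐ⁰] in
/-- the matrix of the pair `(x, (σx)⁻¹)`. [folklore] -/
theorem coe_diagonalGL_pair {x : K} (hx : x ≠ 0) (hσx : σ x ≠ 0) :
    ((diagonalGL (Fin 2) K ![Units.mk0 x hx, (Units.mk0 (σ x) hσx)⁻¹] : GL (Fin 2) K) : Matrix (Fin 2) (Fin 2) K) = Matrix.diagonal ![x, (σ x)⁻¹] := by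
  rw [coe_diagonalGL]
  congr 1
  funext i
  fin_cases i
  · rfl
  · simp [Units.val_inv_eq_inv_val]

/-- `σ x ≠ 0` for `x ≠ 0` when `σ` preserves the valuation. [folklore] -/
theorem map_ne_zero_of_vσ (hvσ : ∀ x, Valued.v (σ x) = Valued.v x) {x : K} (hx : x ≠ 0) : σ x ≠ 0 := by
  intro h
  have := hvσ x
  rw [h, map_zero] at this
  exact hx ((Valuation.zero_iff _).1 this.symm)

/-- **the torus elements `b_j` exist**: for every `x ≠ 0` there is `b ∈ U(σ, J₀)` with matrix `diag(x, (σx)⁻¹)` (★ `diagonalGL_mem_unitaryGroupOfForm_of_norm`).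
[cite: Tits1979, §3.3.2] [cite: BruhatTits1972, (4.4.3)] -/
theorem exists_coe_eq_diagonal_pair (hσ : ∀ x, σ (σ x) = x) (hvσ : ∀ x, Valued.v (σ x) = Valued.v x) {x : K} (hx : x ≠ 0) :
    ∃ b : unitaryGroupOfForm σ ((StdForm.antidiagonal 2).over K), ((b : GL (Fin 2) K) : Matrix (Fin 2) (Fin 2) K) = Matrix.diagonal ![x, (σ x)⁻¹] :=
  ⟨⟨diagonalGL (Fin 2) K ![Units.mk0 x hx, (Units.mk0 (σ x) (map_ne_zero_of_vσ hvσ hx))⁻¹],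
    diagonalGL_mem_unitaryGroupOfForm_of_norm (norm_pair hσ hx _)⟩, coe_diagonalGL_pair hx _⟩

/-- `ϖ ≠ 0` for a uniformiser. [folklore] -/
theorem ne_zero_of_v_eq_exp {ϖ : K} {m : ℤ} (hϖ : Valued.v ϖ = WithZero.exp m) : ϖ ≠ 0 := by
  intro h
  rw [h, map_zero] at hϖ
  exact WithZero.coe_ne_zero hϖ.symm

/-- **a Cartan family exists**: `b : ℕ → U(σ, J₀)` with `(b j) = diag(ϖ^j, (σϖ^j)⁻¹)`, for every uniformiser `ϖ` (indeed every `ϖ ≠ 0`).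
[cite: BruhatTits1972, (4.4.3)] [cite: Tits1979, §3.3.3] -/
theorem exists_cartanFamily_two (hσ : ∀ x, σ (σ x) = x) (hvσ : ∀ x, Valued.v (σ x) = Valued.v x) {ϖ : K} (hϖ0 : ϖ ≠ 0) :
    ∃ b : ℕ → unitaryGroupOfForm σ ((StdForm.antidiagonal 2).over K),
      ∀ j, ((b j : GL (Fin 2) K) : Matrix (Fin 2) (Fin 2) K) = Matrix.diagonal ![ϖ ^ j, (σ (ϖ ^ j))⁻¹] := by
  choose b hb using fun j : ℕ => exists_coe_eq_diagonal_pair hσ hvσ (pow_ne_zero j hϖ0)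
  exact ⟨b, hb⟩

/-- `v(ϖ^j) = exp(−j)`. [folklore] -/
theorem v_pow_eq {ϖ : K} (hϖ : Valued.v ϖ = WithZero.exp (-1 : ℤ)) (j : ℕ) : Valued.v (ϖ ^ j) = WithZero.exp (-(j : ℤ)) := by
  rw [map_pow, hϖ, ← WithZero.exp_nsmul]
  congr 1
  simp

/-- the entries of `b_j = diag(ϖ^j, (σϖ^j)⁻¹)` have valuation `≤ exp j`, … [cite: BruhatTits1972, (4.4.3)] -/
theorem v_apply_le_of_coe_eq_diagonal (hvσ : ∀ x, Valued.v (σ x) = Valued.v x) {ϖ : K} (hϖ : Valued.v ϖ = WithZero.exp (-1 : ℤ)) (j : ℕ)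
    {b : unitaryGroupOfForm σ ((StdForm.antidiagonal 2).over K)}
    (hb : ((b : GL (Fin 2) K) : Matrix (Fin 2) (Fin 2) K) = Matrix.diagonal ![ϖ ^ j, (σ (ϖ ^ j))⁻¹]) (i l : Fin 2) :
    Valued.v (((b : GL (Fin 2) K) : Matrix (Fin 2) (Fin 2) K) i l) ≤ WithZero.exp (j : ℤ) := by
  rw [hb]
  by_cases hil : i = l
  · subst hil
    rw [Matrix.diagonal_apply_eq]
    fin_cases i
    · simp only [Fin.zero_eta, Fin.isValue, Matrix.cons_val_zero, v_pow_eq hϖ, WithZero.exp_le_exp]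
      omega
    · simp only [Fin.mk_one, Fin.isValue, Matrix.cons_val_one, Matrix.cons_val_fin_one, map_inv₀, hvσ, v_pow_eq hϖ, ← WithZero.exp_neg, neg_neg,
        le_refl]
  · rw [Matrix.diagonal_apply_ne _ hil, map_zero]
    exact zero_le

/-- … and the entry `(1,1)` has valuation exactly `exp j`. [cite: BruhatTits1972, (4.4.3)] -/
theorem v_apply_one_one_of_coe_eq_diagonal (hvσ : ∀ x, Valued.v (σ x) = Valued.v x) {ϖ : K} (hϖ : Valued.v ϖ = WithZero.exp (-1 : ℤ)) (j : ℕ)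
    {b : unitaryGroupOfForm σ ((StdForm.antidiagonal 2).over K)}
    (hb : ((b : GL (Fin 2) K) : Matrix (Fin 2) (Fin 2) K) = Matrix.diagonal ![ϖ ^ j, (σ (ϖ ^ j))⁻¹]) :
    Valued.v (((b : GL (Fin 2) K) : Matrix (Fin 2) (Fin 2) K) 1 1) = WithZero.exp (j : ℤ) := by
  rw [hb, Matrix.diagonal_apply_eq]
  simp only [Fin.isValue, Matrix.cons_val_one, Matrix.cons_val_fin_one, map_inv₀, hvσ, v_pow_eq hϖ, ← WithZero.exp_neg, neg_neg]

end Torus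

/-! ## §3 The Cartan decomposition `U(σ, J₀) = ⨆_j K₀ b_j K₀` (`N = 2`, any isometric involution, any uniformiser) -/

section Cartan

variable {σ : K →+* K}

/-- the Weyl flip `swap 0 1` commutes with `rev` on `Fin 2`. [folklore] -/
theorem swap_rev (i : Fin 2) : (Equiv.swap (0 : Fin 2) 1) (Fin.rev i) = Fin.rev ((Equiv.swap (0 : Fin 2) 1) i) := by
  fin_cases i <;> rfl

omit [Valued K ℤᵐ⁰] in
/-- conjugating a diagonal `2 × 2` matrix by the flip swaps its entries. [folklore] -/
theorem permMatrix_swap_mul_diagonal_mul (x y : K) :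
    (Equiv.swap (0 : Fin 2) 1).permMatrix K * Matrix.diagonal ![x, y] * (Equiv.swap (0 : Fin 2) 1).permMatrix K = Matrix.diagonal ![y, x] := by
  ext i j
  fin_cases i <;> fin_cases j <;>
    simp [Matrix.mul_apply, Fin.sum_univ_two, Matrix.diagonal_apply]

/-- **NORMALISATION, integral first entry**: if `k₁ g k₂ = diag(x, (σx)⁻¹)` with `k₁, k₂ ∈ K₀` and `v x = exp(−j)`, then `g ∈ K₀ b_j K₀`
(`diag(x, (σx)⁻¹) = b_j · diag(u, (σu)⁻¹)`, `u = x ∕ ϖ^j` a unit). [cite: BruhatTits1972, (4.4.3)] [cite: Tits1979, §3.3.3] -/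
theorem mem_doubleCoset_of_eq_diagonal (hσ : ∀ x, σ (σ x) = x) (hvσ : ∀ x, Valued.v (σ x) = Valued.v x)
    {ϖ : K} (hϖ : Valued.v ϖ = WithZero.exp (-1 : ℤ)) {j : ℕ}
    {b : unitaryGroupOfForm σ ((StdForm.antidiagonal 2).over K)}
    (hb : ((b : GL (Fin 2) K) : Matrix (Fin 2) (Fin 2) K) = Matrix.diagonal ![ϖ ^ j, (σ (ϖ ^ j))⁻¹])
    {g k₁ k₂ : unitaryGroupOfForm σ ((StdForm.antidiagonal 2).over K)}
    (hk₁ : k₁ ∈ unitaryInt σ ((StdForm.antidiagonal 2).over K)) (hk₂ : k₂ ∈ unitaryInt σ ((StdForm.antidiagonal 2).over K))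
    {x : K} (hx : Valued.v x = WithZero.exp (-(j : ℤ)))
    (heq : (((k₁ * g * k₂ : unitaryGroupOfForm σ ((StdForm.antidiagonal 2).over K)) : GL (Fin 2) K) : Matrix (Fin 2) (Fin 2) K) =
      Matrix.diagonal ![x, (σ x)⁻¹]) :
    g ∈ DoubleCoset.doubleCoset b (unitaryInt σ ((StdForm.antidiagonal 2).over K) : Set _) (unitaryInt σ ((StdForm.antidiagonal 2).over K)) := by
  have hϖ0 : ϖ ≠ 0 := ne_zero_of_v_eq_exp hϖ
  have hx0 : x ≠ 0 := ne_zero_of_v_eq_exp hx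
  have hϖj : ϖ ^ j ≠ 0 := pow_ne_zero j hϖ0
  -- the unit `u = x / ϖ^j` and the unit diagonal `U = diag(u, (σu)⁻¹) ∈ K₀`
  set u : K := x / ϖ ^ j with hu
  have hvu : Valued.v u = 1 := by
    rw [hu, map_div₀, hx, v_pow_eq hϖ, div_self WithZero.coe_ne_zero]
  have hu0 : u ≠ 0 := fun h => by rw [h, map_zero] at hvu; exact zero_ne_one hvu
  have hσu0 : σ u ≠ 0 := map_ne_zero_of_vσ hvσ hu0
  let U : unitaryGroupOfForm σ ((StdForm.antidiagonal 2).over K) :=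
    ⟨diagonalGL (Fin 2) K ![Units.mk0 u hu0, (Units.mk0 (σ u) hσu0)⁻¹], diagonalGL_mem_unitaryGroupOfForm_of_norm (norm_pair hσ hu0 hσu0)⟩
  have hU : U ∈ unitaryInt σ ((StdForm.antidiagonal 2).over K) := by
    refine diagonalGL_mem_unitaryInt_of_norm (norm_pair hσ hu0 hσu0) fun i => ?_
    fin_cases i
    · simp only [Fin.zero_eta, Matrix.cons_val_zero, Units.val_mk0, hvu]
    · simp only [Fin.mk_one, Fin.isValue, Matrix.cons_val_one, Matrix.cons_val_fin_one, Units.val_inv_eq_inv_val, Units.val_mk0, map_inv₀, hvσ,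
        hvu, inv_one]
  -- `k₁ g k₂ = b_j · U`
  have hxu : x = ϖ ^ j * u := by rw [hu, mul_div_cancel₀ _ hϖj]
  have hmat : (((k₁ * g * k₂ : unitaryGroupOfForm σ ((StdForm.antidiagonal 2).over K)) : GL (Fin 2) K) : Matrix (Fin 2) (Fin 2) K) =
      (((b * U : unitaryGroupOfForm σ ((StdForm.antidiagonal 2).over K)) : GL (Fin 2) K) : Matrix (Fin 2) (Fin 2) K) := by
    rw [heq, Subgroup.coe_mul, Units.val_mul, hb]
    change Matrix.diagonal ![x, (σ x)⁻¹] =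
      Matrix.diagonal ![ϖ ^ j, (σ (ϖ ^ j))⁻¹] * ((diagonalGL (Fin 2) K ![Units.mk0 u hu0, (Units.mk0 (σ u) hσu0)⁻¹] : GL (Fin 2) K) : Matrix _ _ K)
    rw [coe_diagonalGL_pair hu0 hσu0, Matrix.diagonal_mul_diagonal]
    congr 1
    funext i
    fin_cases i
    · simp [hxu]
    · simp [hxu, map_mul, mul_comm]
  have hgrp : k₁ * g * k₂ = b * U := Subtype.ext (Units.ext hmat)
  refine DoubleCoset.mem_doubleCoset.2 ⟨k₁⁻¹, Subgroup.inv_mem _ hk₁, U * k₂⁻¹, Subgroup.mul_mem _ hU (Subgroup.inv_mem _ hk₂), ?_⟩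
  calc g = k₁⁻¹ * (k₁ * g * k₂) * k₂⁻¹ := by group
    _ = k₁⁻¹ * b * (U * k₂⁻¹) := by rw [hgrp]; group

/-- **THE RANK-ONE CARTAN DECOMPOSITION AT ANY NON-SPLIT PLACE, as a ★ `IsCartanFamily`.**  `K` a field with a valuation `v : K → ℤᵐ⁰`, `σ` ANY involution
with `v ∘ σ = v`, `ϖ` ANY uniformiser, `b : ℕ → U(σ, J₀)` with `b_j = diag(ϖ^j, (σϖ^j)⁻¹)`: every `g ∈ U(σ, J₀)` lies in EXACTLY ONE `K₀ b_j K₀`,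
`K₀ = U(σ, J₀) ∩ GL₂(𝒪)` — no unramifiedness, no (trace)∕(norm), no `σϖ = ϖ`, every residue characteristic (the stabiliser of a rational hyperbolic lattice
of an isotropic hermitian plane).  COVER: ★ K2E3-p09 `exists_unitaryInt_mul_mul_eq_diagonalGL` + `mem_doubleCoset_of_eq_diagonal` (after the Weyl flip when
`v x > 1`); DISJOINTNESS: the maximal entry valuation on `K₀ b_j K₀` is `exp j` (§1). [cite: BruhatTits1972, (4.4.3)] [cite: Tits1979, §3.3.3] [cite: Macdonald1971, Ch. V §2–§3] -/
theorem isCartanFamily_unitaryInt_two (hσ : ∀ x, σ (σ x) = x) (hvσ : ∀ x, Valued.v (σ x) = Valued.v x)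
    {ϖ : K} (hϖ : Valued.v ϖ = WithZero.exp (-1 : ℤ))
    (b : ℕ → unitaryGroupOfForm σ ((StdForm.antidiagonal 2).over K))
    (hb : ∀ j, ((b j : GL (Fin 2) K) : Matrix (Fin 2) (Fin 2) K) = Matrix.diagonal ![ϖ ^ j, (σ (ϖ ^ j))⁻¹]) :
    IsCartanFamily (unitaryInt σ ((StdForm.antidiagonal 2).over K)) b := by
  classical
  refine ⟨fun g => ?_, fun j j' hjj' => ?_⟩
  · -- COVER
    obtain ⟨k₁, k₂, hk₁, hk₂, d, hdn, heq⟩ := exists_unitaryInt_mul_mul_eq_diagonalGL hσ hvσ 2 g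
    set x : K := (d 0 : K) with hx
    have hx0 : x ≠ 0 := (d 0).ne_zero
    have hd1 : ((d 1 : Kˣ) : K) = (σ x)⁻¹ := by
      have h := hdn 0
      rw [rev_zero_two, ← hx] at h
      exact eq_inv_of_mul_eq_one_right h
    have hdiag : (((k₁ * g * k₂ : unitaryGroupOfForm σ ((StdForm.antidiagonal 2).over K)) : GL (Fin 2) K) : Matrix (Fin 2) (Fin 2) K) =
        Matrix.diagonal ![x, (σ x)⁻¹] := by
      rw [heq, coe_diagonalGL]
      congr 1
      funext i
      fin_cases i
      · rfl
      · exact hd1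
    have hvx0 : Valued.v x ≠ 0 := (Valuation.ne_zero_iff _).2 hx0
    by_cases hle : Valued.v x ≤ 1
    · -- integral first entry: `v x = exp(−j)`
      obtain ⟨j, hj⟩ : ∃ j : ℕ, Valued.v x = WithZero.exp (-(j : ℤ)) := by
        refine ⟨(-WithZero.log (Valued.v x)).toNat, ?_⟩
        have h1 : WithZero.log (Valued.v x) ≤ 0 := by
          rw [← WithZero.exp_log hvx0, ← WithZero.exp_zero, WithZero.exp_le_exp] at hle; exact hle
        rw [Int.toNat_of_nonneg (by omega), neg_neg, WithZero.exp_log hvx0]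
      exact ⟨j, mem_doubleCoset_of_eq_diagonal hσ hvσ hϖ (hb j) hk₁ hk₂ hj hdiag⟩
    · -- `v x > 1`: flip by the Weyl element `w = permGL (swap 0 1) ∈ K₀`, then the first entry `(σx)⁻¹` is integral
      push Not at hle
      let W : unitaryGroupOfForm σ ((StdForm.antidiagonal 2).over K) :=
        ⟨permGL (Equiv.swap (0 : Fin 2) 1), permGL_mem_unitaryGroupOfForm _ swap_rev⟩
      have hW : W ∈ unitaryInt σ ((StdForm.antidiagonal 2).over K) := permGL_mem_unitaryInt _ swap_rev
      set x' : K := (σ x)⁻¹ with hx'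
      have hσx0 : σ x ≠ 0 := map_ne_zero_of_vσ hvσ hx0
      have hvx' : Valued.v x' < 1 := by
        rw [hx', map_inv₀, hvσ]
        exact inv_lt_one_of_one_lt₀ hle
      have hvx'0 : Valued.v x' ≠ 0 := (Valuation.ne_zero_iff _).2 (inv_ne_zero hσx0)
      obtain ⟨j, hj⟩ : ∃ j : ℕ, Valued.v x' = WithZero.exp (-(j : ℤ)) := by
        refine ⟨(-WithZero.log (Valued.v x')).toNat, ?_⟩
        have h1 : WithZero.log (Valued.v x') ≤ 0 := by
          have h2 := hvx'.le
          rw [← WithZero.exp_log hvx'0, ← WithZero.exp_zero, WithZero.exp_le_exp] at h2; exact h2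
        rw [Int.toNat_of_nonneg (by omega), neg_neg, WithZero.exp_log hvx'0]
      have hσx' : (σ x')⁻¹ = x := by rw [hx', map_inv₀, hσ, inv_inv]
      have hdiag' : ((((W * k₁) * g * (k₂ * W) : unitaryGroupOfForm σ ((StdForm.antidiagonal 2).over K)) : GL (Fin 2) K) :
          Matrix (Fin 2) (Fin 2) K) = Matrix.diagonal ![x', (σ x')⁻¹] := by
        have h1 : (W * k₁) * g * (k₂ * W) = W * (k₁ * g * k₂) * W := by group
        rw [h1, Subgroup.coe_mul, Subgroup.coe_mul, Units.val_mul, Units.val_mul, hdiag, hσx']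
        exact permMatrix_swap_mul_diagonal_mul x (σ x)⁻¹
      exact ⟨j, mem_doubleCoset_of_eq_diagonal hσ hvσ hϖ (hb j) (Subgroup.mul_mem _ hW hk₁) (Subgroup.mul_mem _ hk₂ hW) hj hdiag'⟩
  · -- DISJOINTNESS: the maximal entry valuation on `K₀ b_j K₀` is `exp j`
    obtain ⟨g, hg, hg'⟩ := hjj'
    have h1 : WithZero.exp (j : ℤ) ≤ WithZero.exp (j' : ℤ) := by
      obtain ⟨i, l, hil⟩ := exists_le_v_of_mem_doubleCoset 1 1 hg
      rw [v_apply_one_one_of_coe_eq_diagonal hvσ hϖ j (hb j)] at hil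
      exact hil.trans (forall_v_le_of_mem_doubleCoset (v_apply_le_of_coe_eq_diagonal hvσ hϖ j' (hb j')) hg' i l)
    have h2 : WithZero.exp (j' : ℤ) ≤ WithZero.exp (j : ℤ) := by
      obtain ⟨i, l, hil⟩ := exists_le_v_of_mem_doubleCoset 1 1 hg'
      rw [v_apply_one_one_of_coe_eq_diagonal hvσ hϖ j' (hb j')] at hil
      exact hil.trans (forall_v_le_of_mem_doubleCoset (v_apply_le_of_coe_eq_diagonal hvσ hϖ j (hb j)) hg i l)
    have := le_antisymm h1 h2
    rw [WithZero.exp_inj] at this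
    exact_mod_cast this

end Cartan

end Summit.HodgeConjecture.HodgeConjecture.Cruxes.HLiu418.K2LiuRankOneCartanAnyPlace

end
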